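import Summits.QuantumFields.QCD.Theses.QuarksAsStableAction
import Literature.MathematicalPhysics.QuantumLattice.WilsonDiracAP
import Summits.QuantumFields.QCD.Theorems.QuarksAsStableActionWilsonQuarkStability

/-!
# The crux on odd tori from the doubly static gain
(stub `stub_staticReduction` of crux stmt-QuantumFields-9734, line `Sketch`, static route)

Write `D[V] = ‖det D_W[V, m]‖` for the `r = 1` Wilson–Dirac operator of a `U(3)` field `V` on the four-torus
`(ℤ/L)⁴`, `L` odd, `m > -1`.  For a gain orientation `o = (μ, ν)` let `a ≠ b` be the two complementary
directions.  The static slice bound of the sibling crux stmt-QuantumFields-9736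
(`stub_staticSliceBound`, assembled with `stub_cyclicHolder`, `stub_reflectionStep`,
`stub_chessboardOfReflection`, `stub_normDetChainBlock` exactly as in `diamagnetic_odd`, and moved to every
axis by `staticIterate_axisBound`) applied along `a` and then along `b` gives
`D[V]^(L²) ≤ ∏_{s, s'} D[S^b_{s'} S^a_s V]`, and `S^b_{s'} S^a_s V` is the doubly static field `W_y` of the
orientation `o` through any site `y` with `y_a = s`, `y_b = s'` (`staticReduction_field`).  Inserting the
doubly static gain for each `W_y`, the fibrewise bookkeeping of the in-plane plaquette sums
(`staticReduction_fiber`) and the `L²`-th root (`staticReduction_root`) give the gain for the orientation `o`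
(`staticReduction_orient`); the six orientations are then averaged (`staticReduction_root` again with
`n = 6`, `staticReduction_orientSum`), whence the crux on odd tori with `c₁ = c / 6`, `C / 6`, `K`.
Pure theorem file (no definitions, no new axioms).
-/

noncomputable section
open scoped BigOperators Matrix ComplexConjugate
open Finset
open Literature.MathematicalPhysics.QuantumLattice Literature.MathematicalPhysics.QuantumFieldTheory
  Literature.Probability.LatticeModels

namespace Summit.QuantumFields.QCD.Cruxes.CriticalLineDiamagnetism.ChessboardCellGain

open Summit.QuantumFields.QCD.Cruxes.WilsonQuarkStability.FreeTangentLandauChessboard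

/-! ## The static slice bound of the sibling crux, in every direction -/

/-- **The static slice bound in direction `μ` on an odd torus**: `D[V]^L ≤ ∏_s D[S^μ_s V]` for every `U(3)`
field `V` and `m > -1`, where `S^μ_s V` carries the antiperiodic pattern on its `μ`-links and reads the other
links of `V` on the slice `x_μ = s` — `stub_staticSliceBound` (with `stub_cyclicHolder`, `stub_reflectionStep`,
`stub_chessboardOfReflection`, `stub_normDetChainBlock`, verbatim as in `diamagnetic_odd`) moved to the axis `μ`
by `staticIterate_axisBound`. -/
theorem staticReduction_axisBound {L : ℕ} [NeZero L] (hL : Odd L) (μ : Fin 4)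
    (V : GaugeConfig 4 L (Matrix.unitaryGroup (Fin 3) ℂ)) (m : ℝ) (hm : -1 < m) :
    ‖(wilsonDirac (unitaryFundamentalRep (Fin 3) ℂ) V m 1).det‖ ^ L ≤
      ∏ s : ZMod L, ‖(wilsonDirac (unitaryFundamentalRep (Fin 3) ℂ)
        (fun e : Edge 4 L => if e.2 = μ then
            (if e.1 μ = -1 then (-1 : Matrix.unitaryGroup (Fin 3) ℂ) else 1)
          else V (Function.update e.1 μ s, e.2)) m 1).det‖ :=
  staticIterate_axisBound
    (fun W m' hm' => stub_staticSliceBound hL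
      (fun T u hT hu => stub_cyclicHolder
        (fun n T hT U hU e he ι hι c v => stub_reflectionStep n T hT U hU e he ι hι c v)
        (fun n F hF ν hν e ι hιe hrot hrefl hhom c v =>
          stub_chessboardOfReflection n F hF ν hν e ι hιe hrot hrefl hhom c v)
        hL T u hT hu)
      (fun A Pp Pm W' hP hPQ hQP hPph hPmh hW hWp hWm =>
        stub_normDetChainBlock A Pp Pm W' hP hPQ hQP hPph hPmh hW hWp hWm)
      W m' hm')
    μ V m hm

/-! ## Combinatorics of an orientation and its two complementary directions -/

/-- Every orientation `o = (μ < ν)` of the four-torus has two complementary directions `a ≠ b`, and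
`{μ, ν, a, b}` are all four directions. -/
theorem staticReduction_complement : ∀ o : {p : Fin 4 × Fin 4 // p.1 < p.2}, ∃ a b : Fin 4,
    a ≠ b ∧ a ≠ o.1.1 ∧ a ≠ o.1.2 ∧ b ≠ o.1.1 ∧ b ≠ o.1.2 ∧
      ∀ i : Fin 4, i ≠ o.1.1 → i ≠ o.1.2 → i = a ∨ i = b := by
  decide

/-- **The doubly static field.** Two static slice operations along the complementary directions `a` (height
`y a`) and `b` (height `y b`) of an orientation `o = (μ, ν)` produce the doubly static field of `o` through `y`:
the links in the directions `μ, ν` are read off `V` at the site with the `μ, ν`-coordinates of the link and the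
other coordinates of `y`, all other links carry the antiperiodic pattern (`n1` on the seam, `one` off it). -/
theorem staticReduction_field {L : ℕ} {G : Type*} (n1 one : G) (o : {p : Fin 4 × Fin 4 // p.1 < p.2})
    {a b : Fin 4} (hab : a ≠ b) (ha1 : a ≠ o.1.1) (ha2 : a ≠ o.1.2) (hb1 : b ≠ o.1.1) (hb2 : b ≠ o.1.2)
    (hcov : ∀ i : Fin 4, i ≠ o.1.1 → i ≠ o.1.2 → i = a ∨ i = b)
    (V : GaugeConfig 4 L G) (y : Site 4 L) (s s' : ZMod L) (hya : y a = s) (hyb : y b = s') :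
    (fun e : Edge 4 L => if e.2 = b then (if e.1 b = -1 then n1 else one)
      else (fun e' : Edge 4 L => if e'.2 = a then (if e'.1 a = -1 then n1 else one)
          else V (Function.update e'.1 a s, e'.2))
        (Function.update e.1 b s', e.2)) =
      fun e : Edge 4 L => if e.2 = o.1.1 ∨ e.2 = o.1.2 then
          V (fun i => if i = o.1.1 ∨ i = o.1.2 then e.1 i else y i, e.2)
        else (if e.1 e.2 = -1 then n1 else one) := by
  funext ⟨x, j⟩
  simp only []
  by_cases hjb : j = b
  · subst hjb
    rw [if_pos rfl, if_neg (not_or_intro hb1 hb2)]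
  by_cases hja : j = a
  · subst hja
    rw [if_neg hjb, if_pos rfl, if_neg (not_or_intro ha1 ha2)]
    simp only [Function.update_of_ne hab]
  have hj : j = o.1.1 ∨ j = o.1.2 := by
    by_contra h
    rcases hcov j (fun h' => h (Or.inl h')) (fun h' => h (Or.inr h')) with h' | h'
    · exact hja h'
    · exact hjb h'
  rw [if_neg hjb, if_neg hja, if_pos hj]
  congr 2
  funext i
  by_cases hi : i = o.1.1 ∨ i = o.1.2
  · have hia : i ≠ a := by
      rintro rfl
      rcases hi with h' | h'
      · exact ha1 h'
      · exact ha2 h'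
    have hib : i ≠ b := by
      rintro rfl
      rcases hi with h' | h'
      · exact hb1 h'
      · exact hb2 h'
    rw [if_pos hi, Function.update_of_ne hia, Function.update_of_ne hib]
  · rw [if_neg hi]
    rcases hcov i (fun h' => hi (Or.inl h')) (fun h' => hi (Or.inr h')) with rfl | rfl
    · rw [Function.update_self, hya]
    · rw [Function.update_of_ne hab.symm, Function.update_self, hyb]

/-- **Fibrewise bookkeeping of the in-plane sums.** Summing, over the heights `j = (s, s')`, the sums over the
plaquettes of orientation `o` in the plane through `y_j` (`y_j` has `a`-coordinate `s` and `b`-coordinate `s'`)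
gives the sum over all plaquettes of orientation `o`: the planes are the fibres of `p ↦ (p.1 a, p.1 b)`. -/
theorem staticReduction_fiber {L : ℕ} [NeZero L] (o : {p : Fin 4 × Fin 4 // p.1 < p.2})
    {a b : Fin 4} (hab : a ≠ b) (ha1 : a ≠ o.1.1) (ha2 : a ≠ o.1.2) (hb1 : b ≠ o.1.1) (hb2 : b ≠ o.1.2)
    (hcov : ∀ i : Fin 4, i ≠ o.1.1 → i ≠ o.1.2 → i = a ∨ i = b)
    (Q : Plaquette 4 L → Prop) [DecidablePred Q] (φ : Plaquette 4 L → ℝ) :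
    ∑ j : ZMod L × ZMod L, ∑ p ∈ Finset.univ.filter (fun p : Plaquette 4 L =>
        (p.2.1.1 = o.1.1 ∧ p.2.1.2 = o.1.2 ∧ ∀ i, i ≠ o.1.1 → i ≠ o.1.2 →
          p.1 i = (fun i : Fin 4 => if i = a then j.1 else if i = b then j.2 else (0 : ZMod L)) i) ∧ Q p), φ p =
      ∑ p ∈ Finset.univ.filter (fun p : Plaquette 4 L => p.2 = o ∧ Q p), φ p := by
  rw [← Finset.sum_fiberwise (Finset.univ.filter (fun p : Plaquette 4 L => p.2 = o ∧ Q p))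
    (fun p => (p.1 a, p.1 b)) φ]
  refine Finset.sum_congr rfl fun j _ => Finset.sum_congr ?_ fun _ _ => rfl
  ext p
  simp only [Finset.mem_filter, Finset.mem_univ, true_and, Prod.ext_iff]
  constructor
  · rintro ⟨⟨h1, h2, hrest⟩, hQ⟩
    refine ⟨⟨Subtype.ext (Prod.ext h1 h2), hQ⟩, ?_, ?_⟩
    · simpa using hrest a ha1 ha2
    · simpa [hab.symm] using hrest b hb1 hb2
  · rintro ⟨⟨ho, hQ⟩, hja, hjb⟩
    subst ho
    refine ⟨⟨rfl, rfl, fun i hi1 hi2 => ?_⟩, hQ⟩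
    rcases hcov i hi1 hi2 with rfl | rfl
    · simpa using hja
    · simpa [hab.symm] using hjb

/-- **Summing the orientations.** The sums over the plaquettes of each of the six orientations add up to the
sum over all plaquettes (the orientation classes are the fibres of `p ↦ p.2`). -/
theorem staticReduction_orientSum {L : ℕ} [NeZero L] (Q : Plaquette 4 L → Prop) [DecidablePred Q]
    (φ : Plaquette 4 L → ℝ) :
    ∑ o : {p : Fin 4 × Fin 4 // p.1 < p.2},
        ∑ p ∈ Finset.univ.filter (fun p : Plaquette 4 L => p.2 = o ∧ Q p), φ p =
      ∑ p ∈ Finset.univ.filter (fun p : Plaquette 4 L => Q p), φ p := by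
  rw [← Finset.sum_fiberwise (Finset.univ.filter (fun p : Plaquette 4 L => Q p)) (fun p => p.2) φ]
  refine Finset.sum_congr rfl fun o _ => Finset.sum_congr ?_ fun _ _ => rfl
  ext p
  simp only [Finset.mem_filter, Finset.mem_univ, true_and]
  exact and_comm

/-- **The geometric-mean root with exponential weights.** If `x^n ≤ ∏_i f i` over an index type of
cardinality `n ≠ 0`, `0 ≤ f i ≤ exp (e i) · t` with `t ≥ 0`, and `∑_i e i ≤ n E`, then
`x ≤ exp E · t`. -/
theorem staticReduction_root {ι : Type*} [Fintype ι] {n : ℕ} (hn : Fintype.card ι = n) (hn0 : n ≠ 0)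
    {x t E : ℝ} (f e : ι → ℝ) (hx : x ^ n ≤ ∏ i, f i) (hf0 : ∀ i, 0 ≤ f i)
    (hfe : ∀ i, f i ≤ Real.exp (e i) * t) (ht : 0 ≤ t) (he : ∑ i, e i ≤ n * E) :
    x ≤ Real.exp E * t := by
  refine le_of_pow_le_pow_left₀ hn0 (mul_nonneg (Real.exp_nonneg _) ht) (hx.trans ?_)
  calc ∏ i, f i ≤ ∏ i, (Real.exp (e i) * t) := Finset.prod_le_prod (fun i _ => hf0 i) fun i _ => hfe i
    _ = Real.exp (∑ i, e i) * t ^ n := by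
        rw [Finset.prod_mul_distrib, Real.exp_sum, Finset.prod_const, Finset.card_univ, hn]
    _ ≤ Real.exp (n * E) * t ^ n := mul_le_mul_of_nonneg_right (Real.exp_le_exp.2 he) (pow_nonneg ht _)
    _ = (Real.exp E * t) ^ n := by rw [mul_pow, Real.exp_nat_mul]

/-! ## The gain for one orientation -/

/-- **The gain for one orientation.** If the doubly static fields `W_y` of the orientation `o` through every
site `y` gain (`D[W_y] ≤ exp (K - c L² S_y + C L² N_y) D[T]`, `S_y`/`N_y` the good in-plane deficit sum / bad
in-plane count for a deficit function `d` and threshold `δ`), then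
`D[V] ≤ exp (K - c S_o + C N_o) D[T]` with `S_o`, `N_o` the good sum / bad count over ALL plaquettes of
orientation `o`: two static slice bounds (`staticReduction_axisBound`) along the complementary directions,
`staticReduction_field`, `staticReduction_fiber` and the `L²`-th root. -/
theorem staticReduction_orient {L : ℕ} [NeZero L] (hL : Odd L) (o : {p : Fin 4 × Fin 4 // p.1 < p.2})
    {δ c K C m : ℝ} (hm : -1 < m) (V : GaugeConfig 4 L (Matrix.unitaryGroup (Fin 3) ℂ))
    (d : Plaquette 4 L → ℝ)
    (hgain : ∀ y : Site 4 L,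
      ‖(wilsonDirac (unitaryFundamentalRep (Fin 3) ℂ)
          (fun e : Edge 4 L => if e.2 = o.1.1 ∨ e.2 = o.1.2 then
              V (fun i => if i = o.1.1 ∨ i = o.1.2 then e.1 i else y i, e.2)
            else (if e.1 e.2 = -1 then (-1 : Matrix.unitaryGroup (Fin 3) ℂ) else 1)) m 1).det‖ ≤
        Real.exp (K - c * (L : ℝ) ^ 2 * (∑ p ∈ Finset.univ.filter (fun p : Plaquette 4 L =>
              (p.2.1.1 = o.1.1 ∧ p.2.1.2 = o.1.2 ∧ ∀ i, i ≠ o.1.1 → i ≠ o.1.2 → p.1 i = y i) ∧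
                d p < δ), d p)
            + C * (L : ℝ) ^ 2 * ((Finset.univ.filter (fun p : Plaquette 4 L =>
              (p.2.1.1 = o.1.1 ∧ p.2.1.2 = o.1.2 ∧ ∀ i, i ≠ o.1.1 → i ≠ o.1.2 → p.1 i = y i) ∧
                δ ≤ d p)).card : ℝ)) *
          ‖(wilsonDirac (unitaryFundamentalRep (Fin 3) ℂ)
            (fun e : Edge 4 L => if e.1 e.2 = -1 then (-1 : Matrix.unitaryGroup (Fin 3) ℂ) else 1) m 1).det‖) :
    ‖(wilsonDirac (unitaryFundamentalRep (Fin 3) ℂ) V m 1).det‖ ≤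
      Real.exp (K - c * (∑ p ∈ Finset.univ.filter (fun p : Plaquette 4 L => p.2 = o ∧ d p < δ), d p)
          + C * ((Finset.univ.filter (fun p : Plaquette 4 L => p.2 = o ∧ δ ≤ d p)).card : ℝ)) *
        ‖(wilsonDirac (unitaryFundamentalRep (Fin 3) ℂ)
          (fun e : Edge 4 L => if e.1 e.2 = -1 then (-1 : Matrix.unitaryGroup (Fin 3) ℂ) else 1) m 1).det‖ := by
  obtain ⟨a, b, hab, ha1, ha2, hb1, hb2, hcov⟩ := staticReduction_complement o
  have hcard : Fintype.card (ZMod L × ZMod L) = L * L := by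
    rw [Fintype.card_prod, ZMod.card]
  have hn0 : L * L ≠ 0 := mul_ne_zero (NeZero.ne L) (NeZero.ne L)
  -- (1) two static slice bounds and the field identity: `D[V]^(L²) ≤ ∏_{(s,s')} D[W_{y(s,s')}]`
  have hx : ‖(wilsonDirac (unitaryFundamentalRep (Fin 3) ℂ) V m 1).det‖ ^ (L * L) ≤
      ∏ j : ZMod L × ZMod L, ‖(wilsonDirac (unitaryFundamentalRep (Fin 3) ℂ)
        (fun e : Edge 4 L => if e.2 = o.1.1 ∨ e.2 = o.1.2 then
            V (fun i => if i = o.1.1 ∨ i = o.1.2 then e.1 i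
              else (fun i : Fin 4 => if i = a then j.1 else if i = b then j.2 else (0 : ZMod L)) i, e.2)
          else (if e.1 e.2 = -1 then (-1 : Matrix.unitaryGroup (Fin 3) ℂ) else 1)) m 1).det‖ := by
    rw [pow_mul, Fintype.prod_prod_type]
    refine (pow_le_pow_left₀ (pow_nonneg (norm_nonneg _) _)
      (staticReduction_axisBound hL a V m hm) L).trans ?_
    rw [← Finset.prod_pow]
    refine Finset.prod_le_prod (fun s _ => pow_nonneg (norm_nonneg _) _) fun s _ => ?_
    refine (staticReduction_axisBound hL b _ m hm).trans_eq (Finset.prod_congr rfl fun s' _ => ?_)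
    exact congrArg (fun U : GaugeConfig 4 L (Matrix.unitaryGroup (Fin 3) ℂ) =>
        ‖(wilsonDirac (unitaryFundamentalRep (Fin 3) ℂ) U m 1).det‖)
      (staticReduction_field (-1 : Matrix.unitaryGroup (Fin 3) ℂ) 1 o hab ha1 ha2 hb1 hb2 hcov V
        (fun i : Fin 4 => if i = a then (s, s').1 else if i = b then (s, s').2 else (0 : ZMod L))
        s s' (by simp) (by simp [hab.symm]))
  -- (2) the fibrewise bookkeeping of the in-plane sums
  have hS : ∑ j : ZMod L × ZMod L, ∑ p ∈ Finset.univ.filter (fun p : Plaquette 4 L =>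
        (p.2.1.1 = o.1.1 ∧ p.2.1.2 = o.1.2 ∧ ∀ i, i ≠ o.1.1 → i ≠ o.1.2 →
          p.1 i = (fun i : Fin 4 => if i = a then j.1 else if i = b then j.2 else (0 : ZMod L)) i) ∧
          d p < δ), d p =
      ∑ p ∈ Finset.univ.filter (fun p : Plaquette 4 L => p.2 = o ∧ d p < δ), d p :=
    staticReduction_fiber o hab ha1 ha2 hb1 hb2 hcov (fun p => d p < δ) d
  have hN : ∑ j : ZMod L × ZMod L, ((Finset.univ.filter (fun p : Plaquette 4 L =>
        (p.2.1.1 = o.1.1 ∧ p.2.1.2 = o.1.2 ∧ ∀ i, i ≠ o.1.1 → i ≠ o.1.2 →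
          p.1 i = (fun i : Fin 4 => if i = a then j.1 else if i = b then j.2 else (0 : ZMod L)) i) ∧
          δ ≤ d p)).card : ℝ) =
      ((Finset.univ.filter (fun p : Plaquette 4 L => p.2 = o ∧ δ ≤ d p)).card : ℝ) := by
    have h := staticReduction_fiber o hab ha1 ha2 hb1 hb2 hcov (fun p => δ ≤ d p) (fun _ => (1 : ℝ))
    simpa only [Finset.sum_const, nsmul_eq_mul, mul_one] using h
  -- (3) the `L²`-th root
  refine staticReduction_root hcard hn0 _ _ hx (fun _ => norm_nonneg _)
    (fun j => hgain (fun i : Fin 4 => if i = a then j.1 else if i = b then j.2 else (0 : ZMod L)))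
    (norm_nonneg _) (le_of_eq ?_)
  rw [Finset.sum_add_distrib, Finset.sum_sub_distrib, Finset.sum_const, Finset.card_univ, hcard,
    ← Finset.mul_sum, ← Finset.mul_sum, hS, hN, nsmul_eq_mul]
  push_cast
  ring

/-! ## The stub -/

/-- **Stub `stub_staticReduction`** — the crux on ODD tori from the doubly static gain at every orientation:
two static slice bounds of the sibling crux 9736 (`stub_staticSliceBound` with
`stub_cyclicHolder`/`stub_normDetChainBlock`, `staticIterate_axisBound`) in the two directions complementary
to `(μ,ν)` give `‖apDet U‖^(L²) ≤ ∏_y ‖det D_W[W_y]‖`; insert the gain, take the `L²`-th root, and average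
the six orientations (`c₁ = c/6`, `C/6`, `K`). -/
theorem stub_staticReduction : (∃ ε δ c K C : ℝ, 0 < ε ∧ 0 < δ ∧ 0 < c ∧ ∃ L₀ : ℕ, ∀ (L : ℕ) [NeZero L], Odd L → L₀ ≤ L →
      ∀ (m : ℝ), |m| ≤ ε → ∀ (U : GaugeConfig 4 L (Matrix.specialUnitaryGroup (Fin 3) ℂ)) (μ ν : Fin 4), μ < ν → ∀ (y : Site 4 L),
      let V : GaugeConfig 4 L (Matrix.unitaryGroup (Fin 3) ℂ) := fun e =>
        if e.1 e.2 = -1 then -(⟨(U e).1, Matrix.specialUnitaryGroup_le_unitaryGroup (U e).2⟩ : Matrix.unitaryGroup (Fin 3) ℂ)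
        else ⟨(U e).1, Matrix.specialUnitaryGroup_le_unitaryGroup (U e).2⟩;
      let W : GaugeConfig 4 L (Matrix.unitaryGroup (Fin 3) ℂ) := fun e =>
        if e.2 = μ ∨ e.2 = ν then V (fun i => if i = μ ∨ i = ν then e.1 i else y i, e.2)
        else (if e.1 e.2 = -1 then (-1 : Matrix.unitaryGroup (Fin 3) ℂ) else 1);
      let T := fun e : Edge 4 L => if e.1 e.2 = -1 then (-1 : Matrix.unitaryGroup (Fin 3) ℂ) else 1;
      let dfc : GaugeConfig 4 L (Matrix.specialUnitaryGroup (Fin 3) ℂ) → Plaquette 4 L → ℝ := fun U p =>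
        3 - (fundamentalRep (Fin 3) (plaquetteHolonomy U p.1 p.2.1.1 p.2.1.2)).trace.re;
      let inPlane : Plaquette 4 L → Prop := fun p => p.2.1.1 = μ ∧ p.2.1.2 = ν ∧ ∀ i, i ≠ μ → i ≠ ν → p.1 i = y i;
      ‖(wilsonDirac (unitaryFundamentalRep (Fin 3) ℂ) W m 1).det‖ ≤
        Real.exp (K - c * (L : ℝ) ^ 2 * (∑ p ∈ Finset.univ.filter (fun p => inPlane p ∧ dfc U p < δ), dfc U p)
          + C * (L : ℝ) ^ 2 * ((Finset.univ.filter (fun p => inPlane p ∧ δ ≤ dfc U p)).card : ℝ)) *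
        ‖(wilsonDirac (unitaryFundamentalRep (Fin 3) ℂ) T m 1).det‖) →
    ∃ ε δ c₁ K C : ℝ, 0 < ε ∧ 0 < δ ∧ 0 < c₁ ∧ ∃ L₀ : ℕ, ∀ (L : ℕ) [NeZero L], Odd L → L₀ ≤ L → let apDet : Literature.MathematicalPhysics.QuantumFieldTheory.GaugeConfig 4 L (Matrix.specialUnitaryGroup (Fin 3) ℂ) → ℝ → ℂ := fun U m => Literature.MathematicalPhysics.QuantumLattice.fermionDet (Literature.MathematicalPhysics.QuantumLattice.wilsonDirac (Literature.MathematicalPhysics.QuantumLattice.unitaryFundamentalRep (Fin 3) ℂ) (fun e => if e.1 e.2 = -1 then -(⟨(U e).1, Matrix.specialUnitaryGroup_le_unitaryGroup (U e).2⟩ : Matrix.unitaryGroup (Fin 3) ℂ) else ⟨(U e).1, Matrix.specialUnitaryGroup_le_unitaryGroup (U e).2⟩) m 1); let dfc : Literature.MathematicalPhysics.QuantumFieldTheory.GaugeConfig 4 L (Matrix.specialUnitaryGroup (Fin 3) ℂ) → Literature.MathematicalPhysics.QuantumFieldTheory.Plaquette 4 L → ℝ := fun U p => 3 - (Literature.MathematicalPhysics.QuantumLattice.fundamentalRep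 (Fin 3) (Literature.MathematicalPhysics.QuantumFieldTheory.plaquetteHolonomy U p.1 p.2.1.1 p.2.1.2)).trace.re; ∀ m : ℝ, |m| ≤ ε → ∀ U : Literature.MathematicalPhysics.QuantumFieldTheory.GaugeConfig 4 L (Matrix.specialUnitaryGroup (Fin 3) ℂ), ‖apDet U m‖ ≤ Real.exp (K - c₁ * (∑ p ∈ Finset.univ.filter (fun p => dfc U p < δ), dfc U p) + C * ((Finset.univ.filter (fun p => δ ≤ dfc U p)).card : ℝ)) * ‖apDet 1 m‖ := by
  rintro ⟨ε, δ, c, K, C, hε, hδ, hc, L₀, hgain⟩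
  refine ⟨min ε (1 / 2), δ, c / 6, K, C / 6, lt_min hε one_half_pos, hδ, by positivity, L₀, ?_⟩
  intro L _ hLo hL₀ apDet dfc m hm U
  have hmε : |m| ≤ ε := hm.trans (min_le_left _ _)
  have hm1 : -1 < m := by
    have h := (abs_le.1 (hm.trans (min_le_right _ _))).1
    linarith
  -- the crux field and the free field
  let Vx : GaugeConfig 4 L (Matrix.unitaryGroup (Fin 3) ℂ) := fun e =>
    if e.1 e.2 = -1 then
      -(⟨(U e).1, Matrix.specialUnitaryGroup_le_unitaryGroup (U e).2⟩ : Matrix.unitaryGroup (Fin 3) ℂ)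
    else ⟨(U e).1, Matrix.specialUnitaryGroup_le_unitaryGroup (U e).2⟩
  have hT : (fun e : Edge 4 L => if e.1 e.2 = -1 then
      -(⟨((1 : GaugeConfig 4 L (Matrix.specialUnitaryGroup (Fin 3) ℂ)) e).1,
          Matrix.specialUnitaryGroup_le_unitaryGroup
            ((1 : GaugeConfig 4 L (Matrix.specialUnitaryGroup (Fin 3) ℂ)) e).2⟩ : Matrix.unitaryGroup (Fin 3) ℂ)
      else ⟨((1 : GaugeConfig 4 L (Matrix.specialUnitaryGroup (Fin 3) ℂ)) e).1,
          Matrix.specialUnitaryGroup_le_unitaryGroup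
            ((1 : GaugeConfig 4 L (Matrix.specialUnitaryGroup (Fin 3) ℂ)) e).2⟩) =
      fun e : Edge 4 L => if e.1 e.2 = -1 then (-1 : Matrix.unitaryGroup (Fin 3) ℂ) else 1 := by
    funext e
    split_ifs <;> rfl
  have hT1 : ‖apDet 1 m‖ = ‖(wilsonDirac (unitaryFundamentalRep (Fin 3) ℂ)
      (fun e : Edge 4 L => if e.1 e.2 = -1 then (-1 : Matrix.unitaryGroup (Fin 3) ℂ) else 1) m 1).det‖ :=
    congrArg (fun U' : GaugeConfig 4 L (Matrix.unitaryGroup (Fin 3) ℂ) =>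
      ‖(wilsonDirac (unitaryFundamentalRep (Fin 3) ℂ) U' m 1).det‖) hT
  rw [hT1]
  -- the orientation classes partition the plaquettes
  have hS : ∑ o : {p : Fin 4 × Fin 4 // p.1 < p.2},
      ∑ p ∈ Finset.univ.filter (fun p : Plaquette 4 L => p.2 = o ∧ dfc U p < δ), dfc U p =
        ∑ p ∈ Finset.univ.filter (fun p : Plaquette 4 L => dfc U p < δ), dfc U p :=
    staticReduction_orientSum (fun p => dfc U p < δ) (dfc U)
  have hN : ∑ o : {p : Fin 4 × Fin 4 // p.1 < p.2},
      ((Finset.univ.filter (fun p : Plaquette 4 L => p.2 = o ∧ δ ≤ dfc U p)).card : ℝ) =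
        ((Finset.univ.filter (fun p : Plaquette 4 L => δ ≤ dfc U p)).card : ℝ) := by
    have h := staticReduction_orientSum (fun p => δ ≤ dfc U p) (fun _ => (1 : ℝ))
    simpa only [Finset.sum_const, nsmul_eq_mul, mul_one] using h
  -- the gain for each of the six orientations, averaged
  have hco : Fintype.card {p : Fin 4 × Fin 4 // p.1 < p.2} = 6 := by decide
  refine staticReduction_root hco (by norm_num) (fun _ => ‖apDet U m‖) _ ?_
    (fun _ => norm_nonneg _)
    (fun o => staticReduction_orient hLo o hm1 Vx (dfc U) fun y =>
      hgain L hLo hL₀ m hmε U o.1.1 o.1.2 o.2 y)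
    (norm_nonneg _) (le_of_eq ?_)
  · rw [Finset.prod_const, Finset.card_univ, hco]
  · rw [Finset.sum_add_distrib, Finset.sum_sub_distrib, Finset.sum_const, Finset.card_univ,
      hco, ← Finset.mul_sum, ← Finset.mul_sum, hS, hN, nsmul_eq_mul]
    push_cast
    ring

end Summit.QuantumFields.QCD.Cruxes.CriticalLineDiamagnetism.ChessboardCellGain

end
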